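import Mathlib
import HarnessLib
import Summits.ABC.ABC.Theses.TwistAmplification
import Summits.ABC.ABC.Theorems.TwistAmplificationSomeWindowSavingInertBox
import Literature.NumberTheory.DiophantineGeometry.FaltingsHeight
import Literature.NumberTheory.DiophantineGeometry.LocalReduction
import Literature.NumberTheory.DiophantineGeometry.Conductor

/-!
# Sketch — crux `SomeWindowSaving` (stmt-ABC-1976), round 2, ideator 6

No new card is filed by this seat (see `BarrierNotesIdeator6-r2.md`).  This file types the RECUT of
the round-2 card `Ideas/solvable-semistable-base-change.md` (ideator 5) that the parity / no-curve
objection of my barrier notes forces, so that triage and crux-plan can see it elaborate: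

* the (M)/(P) dichotomy of round 1 (`hall-corner-dichotomy`) as two cofinite statements
  `WGSforM` (non-integral `j`, i.e. `¬ Δ ∣ c₄³`) and `WGSforP` (integral `j`), with the
  kernel-checked glue `cofinite_of_dichotomy`;
* the base-change core CUT DOWN to where a Shimura-curve parametrisation over `F` is guaranteed:
  `WGSMultTR ν` = weak Szpiro (Faltings-height form) for SEMISTABLE curves over totally real fields
  of degree `≤ ν` HAVING A PRIME OF MULTIPLICATIVE REDUCTION — this is what (M) needs and all it
  needs (`wgsForM_of_wgsMultTR`, sorry: the transfer of ideator 5 restricted to (M));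
* the Hall kernel left where it was: `ThueHall1728 → WGSforP` (sorry: hall-corner's bookkeeping);
* the composition `someWindowSaving_of_recut`, concluding the crux BY NAME.

Everything enters the crux through the landed `someWindowSaving_of_cofiniteWeakGenSzpiro`
(witness `δ = 0`), hence outside every refuted strengthening of `Disproof.lean` §3/§3'.
-/

noncomputable section

set_option linter.dupNamespace false

open WeierstrassCurve IsDedekindDomain NumberField
open Summit.ABC.ABC.Theses.TwistAmplification

namespace Summit.ABC.ABC.Cruxes.SomeWindowSaving.SketchIdeator6

/-- Conductor of the generic fibre of an integral model, as a real number. -/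
abbrev condR (W₀ : WeierstrassCurve ℤ) : ℝ := (((W₀.baseChange ℚ).conductorNorm ℤ : ℕ) : ℝ)

/-- `M⁺ = max(|Δ|, |c₄|³)` of an integral model, as a real number. -/
abbrev maxInvR (W₀ : WeierstrassCurve ℤ) : ℝ := ((max |W₀.Δ| (|W₀.c₄| ^ 3) : ℤ) : ℝ)

/-- `W₀` is a global minimal integral model of an elliptic curve over `ℚ` with `c₄ c₆ ≠ 0`. -/
def IsGoodModel (W₀ : WeierstrassCurve ℤ) : Prop :=
  (W₀.baseChange ℚ).IsElliptic ∧ (∀ v : HeightOneSpectrum ℤ, (W₀.baseChange ℚ).IsMinimalAt v) ∧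
    W₀.c₄ ≠ 0 ∧ W₀.c₆ ≠ 0

/-- Cofinite weak generalized Szpiro — LITERALLY the hypothesis of the landed
`Summit.ABC.ABC.Theorems.someWindowSaving_of_cofiniteWeakGenSzpiro`. -/
def CofiniteWeakGenSzpiro : Prop :=
  ∃ K N₀ : ℝ, ∀ W₀ : WeierstrassCurve ℤ, (W₀.baseChange ℚ).IsElliptic →
    (∀ v : HeightOneSpectrum ℤ, (W₀.baseChange ℚ).IsMinimalAt v) → W₀.c₄ ≠ 0 → W₀.c₆ ≠ 0 →
      N₀ ≤ (((W₀.baseChange ℚ).conductorNorm ℤ : ℕ) : ℝ) →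
        ((max |W₀.Δ| (|W₀.c₄| ^ 3) : ℤ) : ℝ) ≤ (((W₀.baseChange ℚ).conductorNorm ℤ : ℕ) : ℝ) ^ K

theorem someWindowSaving_of_cofinite (h : CofiniteWeakGenSzpiro) : SomeWindowSaving :=
  Summit.ABC.ABC.Theorems.someWindowSaving_of_cofiniteWeakGenSzpiro h

/-! ## The (M)/(P) dichotomy as two cofinite statements (round-1 structure, retyped) -/

/-- (M): cofinite weak generalized Szpiro for minimal models with NON-integral `j`
(`¬ Δ ∣ c₄³`: some prime of potentially multiplicative reduction). -/
def WGSforM : Prop :=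
  ∃ K N₀ : ℝ, ∀ W₀ : WeierstrassCurve ℤ, IsGoodModel W₀ → ¬ (W₀.Δ ∣ W₀.c₄ ^ 3) →
    N₀ ≤ condR W₀ → maxInvR W₀ ≤ condR W₀ ^ K

/-- (P): cofinite weak generalized Szpiro for minimal models with INTEGRAL `j` (`Δ ∣ c₄³`:
potentially good reduction everywhere; the Hall corner `A X³ − B Y² = 12³`). -/
def WGSforP : Prop :=
  ∃ K N₀ : ℝ, ∀ W₀ : WeierstrassCurve ℤ, IsGoodModel W₀ → W₀.Δ ∣ W₀.c₄ ^ 3 →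
    N₀ ≤ condR W₀ → maxInvR W₀ ≤ condR W₀ ^ K

/-- Glue (kernel-checked): (M) ∧ (P) ⟹ cofinite weak generalized Szpiro.  Uses only
`1 ≤ N` (`conductorNorm_pos_holds` would give it; here we avoid it by taking `N₀ ≥ 1`). -/
theorem cofinite_of_dichotomy (hM : WGSforM) (hP : WGSforP) : CofiniteWeakGenSzpiro := by
  obtain ⟨K₁, N₁, h₁⟩ := hM
  obtain ⟨K₂, N₂, h₂⟩ := hP
  refine ⟨max K₁ K₂, max (max N₁ N₂) 1, fun W₀ hE hmin hc₄ hc₆ hN ↦ ?_⟩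
  have hgood : IsGoodModel W₀ := ⟨hE, hmin, hc₄, hc₆⟩
  have hN1 : (1 : ℝ) ≤ condR W₀ := le_trans (le_max_right _ _) hN
  have hN₁ : N₁ ≤ condR W₀ := le_trans (le_trans (le_max_left _ _) (le_max_left _ _)) hN
  have hN₂ : N₂ ≤ condR W₀ := le_trans (le_trans (le_max_right _ _) (le_max_left _ _)) hN
  by_cases hdiv : W₀.Δ ∣ W₀.c₄ ^ 3
  · calc maxInvR W₀ ≤ condR W₀ ^ K₂ := h₂ W₀ hgood hdiv hN₂
      _ ≤ condR W₀ ^ (max K₁ K₂) := Real.rpow_le_rpow_of_exponent_le hN1 (le_max_right _ _)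
  · calc maxInvR W₀ ≤ condR W₀ ^ K₁ := h₁ W₀ hgood hdiv hN₁
      _ ≤ condR W₀ ^ (max K₁ K₂) := Real.rpow_le_rpow_of_exponent_le hN1 (le_max_left _ _)

/-! ## The base-change core, cut down to where a Shimura CURVE over `F` exists

For a semistable `E/F`, `F` totally real of degree `d`, a parametrisation `X → E` by a Shimura
curve over `F` exists iff `d` is odd OR `E` has a prime of multiplicative reduction (Jacquet–
Langlands: the quaternion algebra must ramify at `d − 1` infinite places and at finitely many
finite places where `π_E` is discrete series, with even total).  Base changes of (M)-curves always
keep a multiplicative prime (potentially multiplicative ⇒ multiplicative once semistable), so (M)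
only needs the following statement; base changes of (P)-curves have GOOD reduction everywhere and,
whenever some twist-minimal semistability defect has even order (`v_p(Δ_min) ∈ {3,9}` at a
`p ≥ 5`, i.e. `p ∣ B` in `A X³ − B Y² = 12³`), force `d` even — no curve, only the totally definite
algebra and central-VALUE quantisation (Ω-homogeneous: bounds heights from below only). -/

/-- `WGSMultTR ν`: weak Szpiro in Faltings-height form for semistable elliptic curves WITH A
MULTIPLICATIVE PRIME over totally real fields of degree `≤ ν`, polynomial (log-linear) in conductor
norm and field discriminant, constants depending on `ν` only.  (Engine-bearing half of ideator 5's
`WGSOverTotallyReal ν`; still open, walled by Hadamard/B3 exactly as over `ℚ`.) -/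
def WGSMultTR (ν : ℕ) : Prop :=
  ∃ K C : ℝ, ∀ (F : Type) [Field F] [NumberField F], IsTotallyReal F →
    Module.finrank ℚ F ≤ ν → ∀ (W : WeierstrassCurve F) [W.IsElliptic], W.IsSemistable (𝓞 F) →
      (∃ v : HeightOneSpectrum (𝓞 F), W.HasMultiplicativeReductionAt v) →
        12 * (Module.finrank ℚ F : ℝ) * W.faltingsHeight ≤
          K * (Real.log ((W.conductorNorm (𝓞 F) : ℕ) : ℝ) +
            Real.log ((NumberField.discr F).natAbs : ℝ)) + C

/-- `SemistabilisingFieldMult ν` (KNOWN mathematics; formalisation XL — Krasner + weak approximation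
with real-rootedness, inheritance of semistability, `potentially multiplicative ⇒ multiplicative`):
every `E/ℚ` with non-integral `j` becomes, over some totally real `F` of degree `≤ ν` with
`log|d_F| ≤ A log N + B`, semistable WITH a multiplicative prime, and `N(𝔣(E/F)) ≤ N^{[F:ℚ]}`. -/
def SemistabilisingFieldMult (ν : ℕ) : Prop :=
  ∃ A B : ℝ, ∀ W₀ : WeierstrassCurve ℤ, (W₀.baseChange ℚ).IsElliptic → ¬ (W₀.Δ ∣ W₀.c₄ ^ 3) →
    ∃ (F : Type) (_ : Field F) (_ : NumberField F), IsTotallyReal F ∧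
      Module.finrank ℚ F ≤ ν ∧
      ((W₀.baseChange ℚ).baseChange F).IsSemistable (𝓞 F) ∧
      (∃ v : HeightOneSpectrum (𝓞 F), ((W₀.baseChange ℚ).baseChange F).HasMultiplicativeReductionAt v) ∧
      Real.log ((NumberField.discr F).natAbs : ℝ) ≤ A * Real.log (condR W₀) + B ∧
      ((((W₀.baseChange ℚ).baseChange F).conductorNorm (𝓞 F) : ℕ) : ℝ) ≤
        condR W₀ ^ (Module.finrank ℚ F : ℝ)

/-- Transfer for (M) (provable now modulo tree API on `faltingsHeight`/`stableFaltingsHeight`: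
base-change invariance of the stable height, `h(E/F) = h_st(E)` for semistable `E/F`, the unstable
discriminant bound `12 h(E/ℚ) − 12 h_st(E) ≤ 5 log N + c`, Silverman's covolume inequality —
ideator 5's B3, restricted to non-integral `j`). -/
theorem wgsForM_of_wgsMultTR (ν : ℕ) :
    SemistabilisingFieldMult ν → WGSMultTR ν → WGSforM := by
  sorry

/-! ## The Hall kernel stays over `ℚ` -/

/-- `ThueHall1728` (hall-corner-dichotomy's (P)-statement, verbatim shape): the two-coefficient
Thue–Hall equation with constant `12³`. -/
def ThueHall1728 : Prop :=
  ∃ K C : ℝ, ∀ A B X Y : ℤ, A ≠ 0 → B ≠ 0 → A * X ^ 3 - B * Y ^ 2 = 1728 →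
    (|X| : ℝ) ≤ C * ((|A * B| : ℤ) : ℝ) ^ K

/-- (P) from `ThueHall1728` (hall-corner's bookkeeping: twist-minimal model, Kodaira tables
`v_p(Δ_min) ∈ {2,3,4,6,8,9,10}` at additive `p ≥ 5`, `|Δ_min| ≤ C N⁵`, `(rad₅A·rad₅B)² ∣ N`,
`|A| ≤ 36 N`, `|B| ≤ 6 √N`; size M). -/
theorem wgsForP_of_thueHall1728 : ThueHall1728 → WGSforP := by
  sorry

/-! ## Parity bookkeeping (kernel-checked triviality recording the obstruction) -/

/-- If every ramification index above `p` is divisible by the (even) order `e` of the semistability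
defect at `p`, the degree `d = Σ eᵢ fᵢ` is even: the shape of "a (P)-curve with a defect of order 4
semistabilises only over EVEN-degree fields". -/
theorem degree_even_of_even_defect {ι : Type*} (s : Finset ι) (e : ℕ) (he : Even e)
    (ram f : ι → ℕ) (hdiv : ∀ i ∈ s, e ∣ ram i) :
    Even (∑ i ∈ s, ram i * f i) := by
  apply Finset.even_sum
  intro i hi
  obtain ⟨k, hk⟩ := hdiv i hi
  rw [hk, mul_assoc]
  exact he.mul_right _

/-! ## Composition: the recut line concludes the crux by name -/

theorem someWindowSaving_of_recut (ν : ℕ) (hF : SemistabilisingFieldMult ν) (hTR : WGSMultTR ν)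
    (hHall : ThueHall1728) : SomeWindowSaving :=
  someWindowSaving_of_cofinite
    (cofinite_of_dichotomy (wgsForM_of_wgsMultTR ν hF hTR) (wgsForP_of_thueHall1728 hHall))

end Summit.ABC.ABC.Cruxes.SomeWindowSaving.SketchIdeator6

end
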